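import Summits.QuantumFields.YangMills.Theorems.LuscherReductionTwistedTraceScalingOfFemtoTraceLaw
import Summits.QuantumFields.YangMills.Theorems.TwistedTraceScaling.Negative.ClockRobustness
import HarnessLib

/-!
# Crux `TwistedTraceScaling` (stmt-QuantumFields-20203) — ideator-1 sketch g3: the PHYSICAL-CLOCK composition, kernel-checked

Crux-ideate #1, GEN 3 (planner `ym-cruxidea-20203-1`).  HONEST FRAMING: support typing for a stub of a child of the CONDITIONAL
reduction route `LuscherReduction` (rung R2b1); not a gap claim, not Clay.  Registry untouched; this file proves no stub BY NAME.

## What this file certifies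

Ideator-2's card `clock-calibration-split` (rev 2, self-declared ABSORBED by skeleton r3) re-coordinatises the femto window by a
finite-volume coupling `v = φ_L(β)` and splits TOWER into `U(v)` (universality at equal `v`) + `Cal(v)` (two-loop calibration of `φ`).
The standing disprover's §H («calibrator = decoration», tree `CmpTwoLoopIffUniformOfBase`) shows that for an ABSTRACT calibrator the split
is strength-neutral.  This sketch types the split for a CONCRETE, externally given lattice observable `G : ℝ → ℕ → ℝ` (intended instance:
the SU(2) Schrödinger-functional coupling `ḡ²_SF(β, L)` of [LNWW92]/[NarayananWolff1995], or the twisted-Polyakov-loop coupling) in the one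
shape in which the split is NOT decoration — the two-lattice comparison `TowerX G` is LABEL-FREE (the two-loop label `invRunningCoupling`,
hence `b₀, b₁`, never enters it except as the fine lattice's regime descriptor `InFemtoWindow`), so it is certifiably free of the two-loop
tax, and the whole tax sits in ONE statement `CalX G` («`G · (1/ḡ²_label) → 1` deep in the window» = two-loop asymptotic scaling of the
concrete coupling, whose perturbative content is in print: `m₂ = m₁² + 2b₁ ln(L/a) + 0.01607` [NarayananWolff1995, p.5]) — and proves,
sorry-free, that the pieces compose to the crux BY NAME:

  `tts_of_physicalClock : SBase → BaseTree G → BaseRegular G → TowerX G → CalX G → LuscherReduction.TwistedTraceScaling`.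

`SBase` is VERBATIM the registered stub `stub_fixedLatticeTraceLaw` (S-BASE); `BaseTree` / `BaseRegular` are fixed-lattice (`β → ∞`)
properties of `G` (tree-level calibration and a continuous positive tail — Laplace asymptotics at fixed `b`, M-size); the matched base coupling
is produced HERE by the intermediate value theorem, so `TowerX` may quantify over ALL matched `β₁ ≥ B` (no uniqueness / monotonicity of `G` needed).
The clock-transfer steps are the tree's `traceLaw_of_asymptoticClock` pattern (monotonicity `traceRatio_mono` + continuity of `r_𝔥`).

Costume guard (same as ideator-2's): with `G := 1/invRunningCoupling` (the label itself) `CalX`, `BaseTree` are trivial and `TowerX` is a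
`B`-guarded TOWER-E1 variant — the content claim is ONLY for a concrete non-degenerate finite-volume coupling (definition request in the addendum).
-/

open MeasureTheory Filter Topology Real
open scoped BigOperators

namespace Summit.QuantumFields.YangMills.Cruxes.TwistedTraceScaling.Ideas.PhysicalClock

open Summit.QuantumFields.YangMills.Theorems.FemtoTransferGap
open Summit.QuantumFields.YangMills.Theorems.FemtoTransferGap.TraceDoor
open Summit.QuantumFields.YangMills.Theorems.FemtoTransferGap.TwoLattice
open Summit.QuantumFields.YangMills.Theorems.TwistedTraceScaling.Negative

/-! ## §0 Statements -/

/-- S-BASE, VERBATIM the registered stub `Stmt.stub_fixedLatticeTraceLaw` of skeleton «twolattice» r1–r3. [cite: Luscher1983, §3] -/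
def SBase : Prop :=
  ∀ (L1 : ℕ) [NeZero L1] (s : ℝ), 0 < s → ∀ ε : ℝ, 0 < ε → ∃ β1 : ℝ, ∀ β : ℝ, β1 ≤ β →
    |traceRatio L1 β (femtoSteps s β L1) - hTraceRatio s| ≤ ε

/-- FTL, VERBATIM the hypothesis of tree `Tower.twistedTraceScaling_of_femtoTraceLaw` (≡ the crux, tree `twistedTraceScaling_iff_femtoTraceLaw`). -/
def FTL : Prop :=
  ∀ s : ℝ, 0 < s → ∀ ε : ℝ, 0 < ε → ∃ lam0 : ℝ, 0 < lam0 ∧ ∀ lam : ℝ, 0 < lam → lam ≤ lam0 →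
    ∃ L0 : ℕ, ∀ (L : ℕ) [NeZero L], L0 ≤ L → ∀ β : ℝ, InFemtoWindow lam β L →
      |traceRatio L β (femtoSteps s β L) - hTraceRatio s| ≤ ε

/-- The physical-clock scale `Λ_G(β, L) := G(β, L)^{1/3}` of a finite-volume coupling `G` (Lüscher: `Λ = ḡ^{2/3}`). [cite: Luscher1983, §3] -/
noncomputable def xLambda (G : ℝ → ℕ → ℝ) (β : ℝ) (L : ℕ) : ℝ := (G β L) ^ ((1 : ℝ) / 3)

/-- Femto steps clocked by `G`: `⌈s·L/Λ_G(β,L)⌉`. -/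
noncomputable def xSteps (G : ℝ → ℕ → ℝ) (s β : ℝ) (L : ℕ) : ℕ := ⌈s * L / xLambda G β L⌉₊

/-- FTL clocked by `G`. -/
def FTLX (G : ℝ → ℕ → ℝ) : Prop :=
  ∀ s : ℝ, 0 < s → ∀ ε : ℝ, 0 < ε → ∃ lam0 : ℝ, 0 < lam0 ∧ ∀ lam : ℝ, 0 < lam → lam ≤ lam0 →
    ∃ L0 : ℕ, ∀ (L : ℕ) [NeZero L], L0 ≤ L → ∀ β : ℝ, InFemtoWindow lam β L →
      |traceRatio L β (xSteps G s β L) - hTraceRatio s| ≤ ε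

/-- CAL-X (THE TAX, concrete and falsifiable): two-loop asymptotic scaling of the concrete coupling — `G(β,L) · (1/ḡ²_label)(β,L) → 1`
deep in the femto window, uniformly. Perturbative content in print: [cite: NarayananWolff1995, p.5 (m₁, m₂)] [cite: LuscherWeiszWolff1991, §2]. -/
def CalX (G : ℝ → ℕ → ℝ) : Prop :=
  ∀ η : ℝ, 0 < η → ∃ lam0 : ℝ, 0 < lam0 ∧ ∀ lam : ℝ, 0 < lam → lam ≤ lam0 →
    ∃ L0 : ℕ, ∀ (L : ℕ) [NeZero L], L0 ≤ L → ∀ β : ℝ, InFemtoWindow lam β L →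
      |G β L * invRunningCoupling β L - 1| ≤ η

/-- BASE-TREE (M): at FIXED lattice size the concrete coupling is tree-level calibrated, `G(β,b)·(1/ḡ²_label)(β,b) → 1` as `β → ∞`
(one-loop finiteness at fixed `b`; Laplace asymptotics). [cite: LuscherNarayananWeiszWolff1992, §6] -/
def BaseTree (G : ℝ → ℕ → ℝ) : Prop :=
  ∀ (b : ℕ) [NeZero b] (η : ℝ), 0 < η → ∃ β1 : ℝ, ∀ β : ℝ, β1 ≤ β → |G β b * invRunningCoupling β b - 1| ≤ η

/-- BASE-REGULAR (S): at fixed lattice size `β ↦ G(β,b)` is continuous and positive on a tail `[B_b, ∞)`. [folklore] -/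
def BaseRegular (G : ℝ → ℕ → ℝ) : Prop :=
  ∀ (b : ℕ) [NeZero b], ∃ B : ℝ, ContinuousOn (fun β : ℝ => G β b) (Set.Ici B) ∧ ∀ β : ℝ, B ≤ β → 0 < G β b

/-- TOWER-X (XL, LABEL-FREE two-lattice universality at matched PHYSICAL coupling): for every block factor there are bases `b ∈ [M, M²)` such
that a fine lattice `L ≥ M²` deep in the window and the base at ANY matched coupling `β₁ ≥ B` (`G(β₁,b) = G(β,L)`) have the same femto trace
ratio at femto time `s` measured by `Λ_G`, up to `ε`.  `b₀, b₁` do not occur; `M = M(s, ε)` absorbs the `O(1/b²)` cutoff effects of the base.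
[cite: LuscherSommerWeiszWolff1993, §2] [cite: Balaban1989LargeFieldII, p.355] -/
def TowerX (G : ℝ → ℕ → ℝ) : Prop :=
  ∀ s : ℝ, 0 < s → ∀ ε : ℝ, 0 < ε → ∃ M : ℕ, 2 ≤ M ∧ ∃ B : ℝ, ∃ lam0 : ℝ, 0 < lam0 ∧ ∀ lam : ℝ, 0 < lam → lam ≤ lam0 →
    ∀ (L : ℕ) [NeZero L], M ^ 2 ≤ L → ∃ (b : ℕ) (_ : NeZero b), M ≤ b ∧ b < M ^ 2 ∧
      ∀ β : ℝ, InFemtoWindow lam β L → ∀ β₁ : ℝ, B ≤ β₁ → G β₁ b = G β L →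
        |traceRatio L β (xSteps G s β L) - traceRatio b β₁ (xSteps G s β₁ b)| ≤ ε

/-! ## §1 Clock comparison: `|G·(1/ḡ²) − 1| ≤ η/2` puts `Λ_G` within relative `η/2` of `Λ`, hence the two step clocks sandwich each other -/

theorem luscherLambda_pos_of_inv_pos {β : ℝ} {L : ℕ} (hinv : 0 < invRunningCoupling β L) : 0 < luscherLambda β L := by
  unfold luscherLambda
  rw [max_eq_left hinv.le]
  exact Real.rpow_pos_of_pos hinv _

theorem xLambda_pow_three {G : ℝ → ℕ → ℝ} {β : ℝ} {L : ℕ} (hG : 0 ≤ G β L) : xLambda G β L ^ 3 = G β L := by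
  unfold xLambda
  rw [← Real.rpow_natCast, ← Real.rpow_mul hG]
  norm_num

/-- The two scales agree to relative `η/2` when the concrete coupling is calibrated to `η/2`. [folklore] -/
theorem clock_sandwich {G : ℝ → ℕ → ℝ} {β : ℝ} {L : ℕ} {η : ℝ} (hη0 : 0 < η) (hη1 : η ≤ 1)
    (hinv : 0 < invRunningCoupling β L) (hcal : |G β L * invRunningCoupling β L - 1| ≤ η / 2) :
    0 < xLambda G β L ∧ (1 - η / 2) * luscherLambda β L ≤ xLambda G β L ∧
      xLambda G β L ≤ (1 + η / 2) * luscherLambda β L := by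
  obtain ⟨hc1, hc2⟩ := abs_le.mp hcal
  have hG : 0 < G β L := by
    by_contra h
    push Not at h
    nlinarith [mul_nonneg (neg_nonneg.2 h) hinv.le]
  have hl : 0 < luscherLambda β L := luscherLambda_pos_of_inv_pos hinv
  have hl3 : luscherLambda β L ^ 3 = (invRunningCoupling β L)⁻¹ := BOHandover.luscherLambda_pow_three hinv
  have hx : 0 < xLambda G β L := Real.rpow_pos_of_pos hG _
  have hx3 : xLambda G β L ^ 3 = G β L := xLambda_pow_three hG.le
  have hkey : xLambda G β L ^ 3 = (G β L * invRunningCoupling β L) * luscherLambda β L ^ 3 := by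
    rw [hx3, hl3]; field_simp
  have hl3pos : 0 < luscherLambda β L ^ 3 := by positivity
  refine ⟨hx, ?_, ?_⟩
  · have h1 : 0 ≤ 1 - η / 2 := by linarith
    have hp : (1 - η / 2) ^ 3 ≤ 1 - η / 2 := pow_le_of_le_one h1 (by linarith) three_ne_zero
    have h3 : ((1 - η / 2) * luscherLambda β L) ^ 3 ≤ xLambda G β L ^ 3 := by
      rw [mul_pow, hkey]
      exact mul_le_mul_of_nonneg_right (hp.trans (by linarith)) hl3pos.le
    exact (pow_le_pow_iff_left₀ (by positivity) hx.le three_ne_zero).1 h3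
  · have hp : 1 + η / 2 ≤ (1 + η / 2) ^ 3 := by nlinarith [mul_nonneg hη0.le (sq_nonneg η)]
    have h3 : xLambda G β L ^ 3 ≤ ((1 + η / 2) * luscherLambda β L) ^ 3 := by
      rw [mul_pow, hkey]
      exact mul_le_mul_of_nonneg_right ((by linarith : G β L * invRunningCoupling β L ≤ 1 + η / 2).trans hp) hl3pos.le
    exact (pow_le_pow_iff_left₀ hx.le (by positivity) three_ne_zero).1 h3

/-- Step sandwiches under calibration `η/2`: each clock at time `s` lies between the other clock at times `(1∓η)s`. [folklore] -/
theorem steps_sandwich {G : ℝ → ℕ → ℝ} {β : ℝ} {L : ℕ} {η s : ℝ} (hs : 0 ≤ s) (hη0 : 0 < η) (hη1 : η ≤ 1)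
    (hinv : 0 < invRunningCoupling β L) (hcal : |G β L * invRunningCoupling β L - 1| ≤ η / 2) :
    femtoSteps ((1 - η) * s) β L ≤ xSteps G s β L ∧ xSteps G s β L ≤ femtoSteps ((1 + η) * s) β L ∧
      xSteps G ((1 - η) * s) β L ≤ femtoSteps s β L ∧ femtoSteps s β L ≤ xSteps G ((1 + η) * s) β L := by
  obtain ⟨hx, hlo, hhi⟩ := clock_sandwich hη0 hη1 hinv hcal
  have hl : 0 < luscherLambda β L := luscherLambda_pos_of_inv_pos hinv
  have hsL : 0 ≤ s * (L : ℝ) := by positivity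
  set x := xLambda G β L with hxdef
  set l := luscherLambda β L with hldef
  -- the four scale inequalities
  have a1 : (1 - η) * x ≤ l := by nlinarith
  have a2 : l ≤ (1 + η) * x := by nlinarith
  have a3 : (1 - η) * l ≤ x := by nlinarith
  have a4 : x ≤ (1 + η) * l := by nlinarith
  unfold xSteps femtoSteps
  rw [← hxdef, ← hldef]
  refine ⟨Nat.ceil_mono ?_, Nat.ceil_mono ?_, Nat.ceil_mono ?_, Nat.ceil_mono ?_⟩
  · rw [div_le_div_iff₀ hl hx]; nlinarith
  · rw [div_le_div_iff₀ hx hl]; nlinarith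
  · rw [div_le_div_iff₀ hx hl]; nlinarith
  · rw [div_le_div_iff₀ hl hx]; nlinarith

/-! ## §2 BASE side: S-BASE + tree-level calibration at fixed lattice ⇒ the base law clocked by `G` -/

/-- A relative time shift small for `r_𝔥`'s continuity. [folklore] -/
theorem exists_eta {s δ : ℝ} (hs : 0 < s) (hδ : 0 < δ) : ∃ η : ℝ, 0 < η ∧ η ≤ 1 / 2 ∧ η * s < δ := by
  refine ⟨min (δ / (2 * s)) (1 / 2), by positivity, min_le_right _ _, ?_⟩
  calc min (δ / (2 * s)) (1 / 2) * s ≤ δ / (2 * s) * s := mul_le_mul_of_nonneg_right (min_le_left _ _) hs.le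
    _ = δ / 2 := by field_simp
    _ < δ := by linarith

/-- **Base law at the physical clock** (fixed lattice, `β → ∞`): from S-BASE at the neighbouring label times, tree-level calibration `BaseTree`,
monotonicity in `T` (`traceRatio_mono`) and continuity of `r_𝔥`. [cite: Luscher1983, §3] -/
theorem baseLawX {G : ℝ → ℕ → ℝ} (hS : SBase) (hT : BaseTree G) (b : ℕ) [NeZero b] (s : ℝ) (hs : 0 < s) (ε : ℝ) (hε : 0 < ε) :
    ∃ β1 : ℝ, ∀ β : ℝ, β1 ≤ β → |traceRatio b β (xSteps G s β b) - hTraceRatio s| ≤ ε := by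
  obtain ⟨δ, hδ, hcont⟩ := Metric.continuousAt_iff.mp (continuousAt_hTraceRatio hs) (ε / 2) (by positivity)
  obtain ⟨η, hη0, hη1, hηs⟩ := exists_eta hs hδ
  have hs1 : 0 < (1 - η) * s := by nlinarith
  have hs2 : 0 < (1 + η) * s := by positivity
  have hr1 : |hTraceRatio ((1 - η) * s) - hTraceRatio s| < ε / 2 := by
    have h := hcont (x := (1 - η) * s)
      (by rw [Real.dist_eq, show (1 - η) * s - s = -(η * s) by ring, abs_neg, abs_of_pos (by positivity)]; exact hηs)
    rwa [Real.dist_eq] at h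
  have hr2 : |hTraceRatio ((1 + η) * s) - hTraceRatio s| < ε / 2 := by
    have h := hcont (x := (1 + η) * s)
      (by rw [Real.dist_eq, show (1 + η) * s - s = η * s by ring, abs_of_pos (by positivity)]; exact hηs)
    rwa [Real.dist_eq] at h
  obtain ⟨βA, HA⟩ := hS b ((1 - η) * s) hs1 (ε / 2) (by positivity)
  obtain ⟨βB, HB⟩ := hS b ((1 + η) * s) hs2 (ε / 2) (by positivity)
  obtain ⟨βT, HT⟩ := hT b (η / 2) (by positivity)
  obtain ⟨βU, HU⟩ := Base.eventually_unit_le b (τ := (1 - η) * s / 2) (by positivity)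
  refine ⟨max (max βA βB) (max βT βU), fun β hβ => ?_⟩
  have hβA : βA ≤ β := ((le_max_left _ _).trans (le_max_left _ _)).trans hβ
  have hβB : βB ≤ β := ((le_max_right _ _).trans (le_max_left _ _)).trans hβ
  have hβT : βT ≤ β := ((le_max_left _ _).trans (le_max_right _ _)).trans hβ
  have hβU : βU ≤ β := ((le_max_right _ _).trans (le_max_right _ _)).trans hβ
  obtain ⟨hβ1, hupos, hule⟩ := HU β hβU
  have hbpos : (0 : ℝ) < b := by exact_mod_cast Nat.pos_of_ne_zero (NeZero.ne b)
  have hl : 0 < luscherLambda β b := by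
    have := mul_pos hupos hbpos
    rwa [div_mul_cancel₀ _ hbpos.ne'] at this
  have hinv : 0 < invRunningCoupling β b := BOHandover.invRunningCoupling_pos_of_luscherLambda_pos hl
  obtain ⟨hlo, hhi, -, -⟩ := steps_sandwich (G := G) hs.le hη0 (by linarith) hinv (HT β hβT)
  -- the lower neighbouring clock has at least two steps
  have hT1 : 2 ≤ femtoSteps ((1 - η) * s) β b := by
    have h1 : 1 < femtoSteps ((1 - η) * s) β b := by
      unfold femtoSteps
      refine Nat.lt_ceil.mpr ?_
      rw [Nat.cast_one, lt_div_iff₀ hl]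
      have h2 : luscherLambda β b ≤ (1 - η) * s / 2 * b := by rwa [div_le_iff₀ hbpos] at hule
      nlinarith
    omega
  have m1 := traceRatio_mono b hβ1 hT1 hlo
  have m2 := traceRatio_mono b hβ1 (hT1.trans hlo) hhi
  have eA := abs_le.mp (HA β hβA)
  have eB := abs_le.mp (HB β hβB)
  have f1 := abs_lt.mp hr1
  have f2 := abs_lt.mp hr2
  rw [abs_le]
  constructor <;> linarith

/-! ## §3 FINE side: the law at the physical clock + CAL-X ⇒ FTL (clock transfer, `traceLaw_of_asymptoticClock` pattern) -/

/-- **FTL from FTL-X and CAL-X.** [folklore] -/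
theorem ftl_of_ftlX {G : ℝ → ℕ → ℝ} (hX : FTLX G) (hC : CalX G) : FTL := by
  intro s hs ε hε
  obtain ⟨δ, hδ, hcont⟩ := Metric.continuousAt_iff.mp (continuousAt_hTraceRatio hs) (ε / 2) (by positivity)
  obtain ⟨η, hη0, hη1, hηs⟩ := exists_eta hs hδ
  have hs1 : 0 < (1 - η) * s := by nlinarith
  have hs2 : 0 < (1 + η) * s := by positivity
  have hr1 : |hTraceRatio ((1 - η) * s) - hTraceRatio s| < ε / 2 := by
    have h := hcont (x := (1 - η) * s)
      (by rw [Real.dist_eq, show (1 - η) * s - s = -(η * s) by ring, abs_neg, abs_of_pos (by positivity)]; exact hηs)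
    rwa [Real.dist_eq] at h
  have hr2 : |hTraceRatio ((1 + η) * s) - hTraceRatio s| < ε / 2 := by
    have h := hcont (x := (1 + η) * s)
      (by rw [Real.dist_eq, show (1 + η) * s - s = η * s by ring, abs_of_pos (by positivity)]; exact hηs)
    rwa [Real.dist_eq] at h
  obtain ⟨lamA, hlamA, HA⟩ := hX ((1 - η) * s) hs1 (ε / 2) (by positivity)
  obtain ⟨lamB, hlamB, HB⟩ := hX ((1 + η) * s) hs2 (ε / 2) (by positivity)
  obtain ⟨lamC, hlamC, HC⟩ := hC (η / 2) (by positivity)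
  refine ⟨min (min lamA lamB) (min lamC 1), lt_min (lt_min hlamA hlamB) (lt_min hlamC one_pos), fun lam hl0 hle => ?_⟩
  have hlA : lam ≤ lamA := hle.trans ((min_le_left _ _).trans (min_le_left _ _))
  have hlB : lam ≤ lamB := hle.trans ((min_le_left _ _).trans (min_le_right _ _))
  have hlC : lam ≤ lamC := hle.trans ((min_le_right _ _).trans (min_le_left _ _))
  have hl_one : lam ≤ 1 := hle.trans ((min_le_right _ _).trans (min_le_right _ _))
  obtain ⟨LA, HLA⟩ := HA lam hl0 hlA
  obtain ⟨LB, HLB⟩ := HB lam hl0 hlB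
  obtain ⟨LC, HLC⟩ := HC lam hl0 hlC
  refine ⟨max (max LA LB) (max LC (⌈6 / s⌉₊ + 1)), fun L _ hL β hW => ?_⟩
  have hLA : LA ≤ L := ((le_max_left _ _).trans (le_max_left _ _)).trans hL
  have hLB : LB ≤ L := ((le_max_right _ _).trans (le_max_left _ _)).trans hL
  have hLC : LC ≤ L := ((le_max_left _ _).trans (le_max_right _ _)).trans hL
  have hL6 : ⌈6 / s⌉₊ + 1 ≤ L := ((le_max_right _ _).trans (le_max_right _ _)).trans hL
  have hl : 0 < luscherLambda β L := luscherLambda_pos_of_window hl0 hW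
  have hinv : 0 < invRunningCoupling β L := BOHandover.invRunningCoupling_pos_of_luscherLambda_pos hl
  have hcal := HLC L hLC β hW
  obtain ⟨hx, -, hxle⟩ := clock_sandwich hη0 (by linarith) hinv hcal
  obtain ⟨-, -, hlo, hhi⟩ := steps_sandwich (G := G) hs.le hη0 (by linarith) hinv hcal
  -- the lower neighbouring clock has at least two steps: `Λ_G ≤ (1+η/2)Λ ≤ 3·lam ≤ 3` and `sL > 6`
  have hsL : 6 < s * L := by
    have h1 : (6 / s : ℝ) < L := (Nat.le_ceil _).trans_lt (by exact_mod_cast hL6)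
    rw [div_lt_iff₀ hs] at h1
    linarith
  have hx3 : xLambda G β L ≤ 3 := by nlinarith [hW.2.2]
  have hT1 : 2 ≤ xSteps G ((1 - η) * s) β L := by
    have h1 : 1 < xSteps G ((1 - η) * s) β L := by
      unfold xSteps
      refine Nat.lt_ceil.mpr ?_
      rw [Nat.cast_one, lt_div_iff₀ hx]
      nlinarith
    omega
  have m1 := traceRatio_mono L hW.1 hT1 hlo
  have m2 := traceRatio_mono L hW.1 (hT1.trans hlo) hhi
  have eA := abs_le.mp (HLA L hLA β hW)
  have eB := abs_le.mp (HLB L hLB β hW)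
  have f1 := abs_lt.mp hr1
  have f2 := abs_lt.mp hr2
  rw [abs_le]
  constructor <;> linarith

/-! ## §4 TOWER-X + base law + IVT matching ⇒ the law at the physical clock -/

/-- **FTL-X from TOWER-X** (label-free comparison), the base law at the physical clock, a regular tail of `G` at each base, and coarse
calibration (`CalX` at `η = 1/2`, only to make `G(β,L)` small deep in the window so that a matched `β₁` EXISTS by the intermediate value theorem). -/
theorem ftlX_of_towerX {G : ℝ → ℕ → ℝ} (hS : SBase) (hT : BaseTree G) (hR : BaseRegular G) (hTow : TowerX G) (hC : CalX G) :
    FTLX G := by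
  intro s hs ε hε
  obtain ⟨M, hM2, B, lamT, hlamT, HT⟩ := hTow s hs (ε / 2) (by positivity)
  -- base laws at the physical clock, as a threshold function on all of ℕ
  have hbl : ∀ b : ℕ, ∃ β1 : ℝ, ∀ (hb : b ≠ 0) (β : ℝ), β1 ≤ β →
      |@traceRatio b ⟨hb⟩ β (xSteps G s β b) - hTraceRatio s| ≤ ε / 2 := by
    intro b
    by_cases hb : b = 0
    · exact ⟨0, fun h => absurd hb h⟩
    · haveI : NeZero b := ⟨hb⟩
      obtain ⟨β1, h⟩ := baseLawX hS hT b s hs (ε / 2) (by positivity)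
      exact ⟨β1, fun _ β hβ => h β hβ⟩
  choose fβ hfβ using hbl
  have hreg : ∀ b : ℕ, ∃ Bb : ℝ, ∀ (hb : b ≠ 0),
      ContinuousOn (fun β : ℝ => G β b) (Set.Ici Bb) ∧ ∀ β : ℝ, Bb ≤ β → 0 < G β b := by
    intro b
    by_cases hb : b = 0
    · exact ⟨0, fun h => absurd hb h⟩
    · haveI : NeZero b := ⟨hb⟩
      obtain ⟨Bb, h⟩ := hR b
      exact ⟨Bb, fun _ => h⟩
  choose fB hfB using hreg
  -- a common threshold for the finitely many bases `b < M²`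
  set βstar : ℝ := max (max B 1) (∑ i ∈ Finset.range (M ^ 2), (|fβ i| + |fB i|)) with hβstar
  have hstar : ∀ b : ℕ, b < M ^ 2 → fβ b ≤ βstar ∧ fB b ≤ βstar := by
    intro b hb
    have hsum : |fβ b| + |fB b| ≤ ∑ i ∈ Finset.range (M ^ 2), (|fβ i| + |fB i|) :=
      Finset.single_le_sum (f := fun i => |fβ i| + |fB i|) (fun i _ => by positivity) (Finset.mem_range.2 hb)
    have h1 := le_abs_self (fβ b)
    have h2 := le_abs_self (fB b)
    have h3 : ∑ i ∈ Finset.range (M ^ 2), (|fβ i| + |fB i|) ≤ βstar := le_max_right _ _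
    exact ⟨by linarith [abs_nonneg (fB b)], by linarith [abs_nonneg (fβ b)]⟩
  have hBstar : B ≤ βstar := (le_max_left _ _).trans (le_max_left _ _)
  -- the smallest value of `G(βstar, ·)` over the candidate bases is positive
  have hMM : M < M ^ 2 := by nlinarith
  have hne : (Finset.Ico M (M ^ 2)).Nonempty := ⟨M, Finset.mem_Ico.2 ⟨le_rfl, hMM⟩⟩
  set gmin : ℝ := (Finset.Ico M (M ^ 2)).inf' hne (fun b => G βstar b) with hgmin
  have hgpos : 0 < gmin := by
    refine (Finset.lt_inf'_iff hne).2 fun b hb => ?_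
    have hb' := Finset.mem_Ico.1 hb
    have hb0 : b ≠ 0 := by omega
    exact (hfB b hb0).2 βstar (hstar b hb'.2).2
  have hgle : ∀ b : ℕ, M ≤ b → b < M ^ 2 → gmin ≤ G βstar b := fun b h1 h2 =>
    Finset.inf'_le (fun b => G βstar b) (Finset.mem_Ico.2 ⟨h1, h2⟩)
  -- coarse calibration: deep in the window `G(β, L) ≤ 12·lam³`
  obtain ⟨lamC, hlamC, HC⟩ := hC (1 / 2) (by norm_num)
  refine ⟨min (min lamT lamC) (min 1 (gmin / 13)),
    lt_min (lt_min hlamT hlamC) (lt_min one_pos (by positivity)), fun lam hl0 hle => ?_⟩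
  have hlT : lam ≤ lamT := hle.trans ((min_le_left _ _).trans (min_le_left _ _))
  have hlC : lam ≤ lamC := hle.trans ((min_le_left _ _).trans (min_le_right _ _))
  have hl1 : lam ≤ 1 := hle.trans ((min_le_right _ _).trans (min_le_left _ _))
  have hlg : lam ≤ gmin / 13 := hle.trans ((min_le_right _ _).trans (min_le_right _ _))
  obtain ⟨LC, HLC⟩ := HC lam hl0 hlC
  refine ⟨max (M ^ 2) LC, fun L _ hL β hW => ?_⟩
  have hLM : M ^ 2 ≤ L := (le_max_left _ _).trans hL
  have hLC : LC ≤ L := (le_max_right _ _).trans hL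
  obtain ⟨b, hbI, hMb, hbM, HTb⟩ := HT lam hl0 hlT L hLM
  have hb0 : b ≠ 0 := by omega
  -- the value to match and its size
  have hinvL : 1 / (8 * lam ^ 3) ≤ invRunningCoupling β L := invRunningCoupling_ge_of_window hl0 hW
  have hinvpos : 0 < invRunningCoupling β L := lt_of_lt_of_le (by positivity) hinvL
  obtain ⟨hc1, hc2⟩ := abs_le.mp (HLC L hLC β hW)
  have hvpos : 0 < G β L := by
    by_contra h
    push Not at h
    nlinarith [mul_nonneg (neg_nonneg.2 h) hinvpos.le]
  have hvle : G β L < gmin := by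
    have h1 : G β L * invRunningCoupling β L ≤ 3 / 2 := by linarith
    have h2 : G β L ≤ 12 * lam ^ 3 := by
      have h3 : G β L * (1 / (8 * lam ^ 3)) ≤ 3 / 2 :=
        (mul_le_mul_of_nonneg_left hinvL hvpos.le).trans h1
      rw [mul_one_div, div_le_iff₀ (by positivity)] at h3
      linarith
    have h4 : lam ^ 3 ≤ lam := by
      have := pow_le_of_le_one hl0.le hl1 three_ne_zero
      simpa using this
    nlinarith
  -- a matched base coupling `β₁ ∈ [βstar, N]` by the intermediate value theorem
  obtain ⟨βstar_le_f, βstar_le_B⟩ := hstar b hbM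
  obtain ⟨hcont, hposG⟩ := hfB b hb0
  haveI : NeZero b := hbI
  obtain ⟨β2, Hβ2⟩ := hT b (1 / 2) (by norm_num)
  set K : ℝ := b1 / b0 - 2 * b0 * Real.log (b : ℝ) with hK
  set N : ℝ := max (max βstar β2) (max 1 ((3 / (2 * G β L) - K) * (242 / 19))) with hN
  have hNstar : βstar ≤ N := (le_max_left _ _).trans (le_max_left _ _)
  have hN2 : β2 ≤ N := (le_max_right _ _).trans (le_max_left _ _)
  have hN1 : 1 ≤ N := (le_max_left _ _).trans (le_max_right _ _)
  have hNK : (3 / (2 * G β L) - K) * (242 / 19) ≤ N := (le_max_right _ _).trans (le_max_right _ _)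
  have hinvN : 3 / (2 * G β L) ≤ invRunningCoupling N b := by
    have hge := Base.invRunningCoupling_ge' (lt_of_lt_of_le one_pos hN1) b
    rw [← hK] at hge
    nlinarith
  have hinvNpos : 0 < invRunningCoupling N b := lt_of_lt_of_le (by positivity) hinvN
  have hGN : G N b ≤ G β L := by
    obtain ⟨-, h2⟩ := abs_le.mp (Hβ2 N hN2)
    have h3 : G N b * invRunningCoupling N b ≤ 3 / 2 := by linarith
    have h4 : G N b * (3 / (2 * G β L)) ≤ 3 / 2 :=
      (mul_le_mul_of_nonneg_left hinvN (hposG N (βstar_le_B.trans hNstar)).le).trans h3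
    rw [mul_div_assoc', div_le_iff₀ (by positivity)] at h4
    nlinarith
  have hGstar : G β L ≤ G βstar b := hvle.le.trans (hgle b hMb hbM)
  have hcont' : ContinuousOn (fun β : ℝ => G β b) (Set.Icc βstar N) :=
    hcont.mono fun x hx => (βstar_le_B.trans hx.1 : fB b ≤ x)
  obtain ⟨β₁, hmem, hval⟩ := intermediate_value_Icc' hNstar hcont' ⟨hGN, hGstar⟩
  -- compare and conclude
  have hcmp := HTb β hW β₁ (hBstar.trans hmem.1) hval
  have hbase := hfβ b hb0 β₁ (βstar_le_f.trans hmem.1)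
  calc |traceRatio L β (xSteps G s β L) - hTraceRatio s|
      = |(traceRatio L β (xSteps G s β L) - traceRatio b β₁ (xSteps G s β₁ b)) +
          (traceRatio b β₁ (xSteps G s β₁ b) - hTraceRatio s)| := by congr 1; ring
    _ ≤ |traceRatio L β (xSteps G s β L) - traceRatio b β₁ (xSteps G s β₁ b)| +
          |traceRatio b β₁ (xSteps G s β₁ b) - hTraceRatio s| := abs_add_le _ _
    _ ≤ ε := by linarith

/-! ## §5 ★ The composition to the crux BY NAME -/

/-- ★ **The crux from the physical-clock split**: S-BASE, tree-level calibration and a regular tail of the concrete coupling at each fixed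
lattice, LABEL-FREE two-lattice universality at matched physical coupling, and the two-loop asymptotic scaling of the concrete coupling
(CAL-X, the tax) imply `TwistedTraceScaling` (via tree `Tower.twistedTraceScaling_of_femtoTraceLaw`).  Sorry-free. -/
theorem tts_of_physicalClock (G : ℝ → ℕ → ℝ) (hS : SBase) (hT : BaseTree G) (hR : BaseRegular G) (hTow : TowerX G) (hC : CalX G) :
    Summit.QuantumFields.YangMills.Theses.LuscherReduction.TwistedTraceScaling :=
  Tower.twistedTraceScaling_of_femtoTraceLaw (ftl_of_ftlX (ftlX_of_towerX hS hT hR hTow hC) hC)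

/-- The same, concluding FTL (for lines that prefer the tree's `FTL ⟺ crux` door). -/
theorem ftl_of_physicalClock (G : ℝ → ℕ → ℝ) (hS : SBase) (hT : BaseTree G) (hR : BaseRegular G) (hTow : TowerX G) (hC : CalX G) :
    FTL :=
  ftl_of_ftlX (ftlX_of_towerX hS hT hR hTow hC) hC


end Summit.QuantumFields.YangMills.Cruxes.TwistedTraceScaling.Ideas.PhysicalClock
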